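import Summits.BirchSwinnertonDyer.BirchSwinnertonDyer.Theorems.RamifiedSevenEllipticUnitsKummerFrameCompat
import HarnessLib

/-!
# K7r crux `EllipticUnitValueSeven` (stmt-BirchSwinnertonDyer-19705), line `rubin-formula`, stub S_dict
# `stub_localMordellWeilDictSeven`: the `±`-CHART OF `E(K_𝔭)` AT AN O11 FRAME and its values on the
# global points (cell `bsd-cm`, seat `bsd-cm-k7r-c3` g6; helper file, `--supports` 19705)

HONEST FRAMING. Nothing is asserted about the crux; BSD is not proved by any of this; a closed item
closes a rung leaf of BirchSwinnertonDyer at most. At an O11 frame `(K, 𝔭, W', C)` of `(W, p)`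
(`X12.O11.IsFrame`: `W` CM, `p ≥ 5` ramified in the CM field `K = ℚ(√−p)`, `𝔭 ∣ p`, `W' = C • W^{(−p)}`)
we construct (`exists_frameChart`) an additive CHART

  `Φ : E(K_𝔭) = (W_K ⊗ K_𝔭)(K_𝔭) → ℤ_p × ℤ_p`, kernel = torsion, ONTO,

together with the charts `λ = Ψ : E(ℚ_p) → ℤ_p`, `λ' : E'(ℚ_p) → ℤ_p` of the tree's `X11b.LocalIndex.psi`
(AEC VII.6.3; torsion kernel; onto because `E(ℚ_p)[p] = 0 = E'(ℚ_p)[p]` at a frame), such that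
(V1) `Φ(P) = (λ(P), 0)` for `P ∈ E(ℚ)`, (V2) every `P' ∈ E'(ℚ)` has a twist `T ∈ E(K)` with
`Φ(T) = (0, λ'(P'))`, (V3) for every `R ∈ E(K)` there are `Q ∈ E(ℚ)`, `Q' ∈ E'(ℚ)` with
`Φ(R) = (u λ(Q), u λ'(Q'))`, `2u = 1` — the GLOBAL quadratic descent `2E(K) ⊆ E(ℚ) + τ E'(ℚ)`.
Construction: `K_𝔭 = F(θ)`, `F = ℚ_v ≅ ℚ_p` (`v = (p)`), `θ = √−p ∉ F`, `[K_𝔭 : F] = 2` (as in k7r-c4's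
`noPTorsion_adicCompletion_of_isFrame`); the tree's quadratic descent (`QuadraticDescent.incl`,
`twistMap`, `conjMap`; Silverman Ex. 10.16) on the completed-square model over `F` and over `ℚ`, fed to
the abstract `±`-chart `KummerCore.exists_plusMinusChart`; transport along the changes of variables
(`VariableChange.pointEquivBaseChange`) using the compatibilities of
`RamifiedSevenEllipticUnitsKummerFrameCompat.lean`. With
`KummerCore.hasLocalMordellWeilIndexExpOfEmb_top_iff_index` this yields S_dict (assembly file).
References: J. H. Silverman, *AEC* (2009) X.2 Prop. 2.4, X.5 Cor. 5.4, Exercise 10.16, Prop. VII.6.3;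
cell memo `STUB-PLAN-stub_localMordellWeilDictSeven.md` (L3–L5).
-/

set_option linter.dupNamespace false

noncomputable section

open scoped Classical

open WeierstrassCurve NumberField IsDedekindDomain Field
  Literature.NumberTheory.EllipticCurves Literature.NumberTheory.QuadraticFields
  Literature.NumberTheory.EllipticCurves.Rank1Residual
  WeierstrassCurve.QuadraticDescent
  Summit.BirchSwinnertonDyer.Rank1Residual

namespace Summit.BirchSwinnertonDyer.BirchSwinnertonDyer.Theorems.RamifiedSevenEllipticUnits.KummerCore

/-! ## §4 The chart at an O11 frame -/

section Frame

open Summit.BirchSwinnertonDyer.Rank1Residual.X11b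

set_option maxHeartbeats 400000 in
/-- **THE `±`-CHART OF `E(K_𝔭)` AT AN O11 FRAME** (module docstring): for a globally minimal `W/ℚ`
with an O11 frame `(K, 𝔭, W', C)` at `p`, there are an additive `Φ : (W_K ⊗ K_𝔭)(K_𝔭) → ℤ_p × ℤ_p`
with kernel the torsion and onto, the charts `λ = Ψ : W(ℚ_p) → ℤ_p`, `λ' = Ψ' : W'(ℚ_p) → ℤ_p`
(torsion kernel, onto), and `u` with `2u = 1`, such that (V1) `Φ(P) = (λ P, 0)` on `P ∈ W(ℚ)`,
(V2) every `P' ∈ W'(ℚ)` has a `T ∈ W_K(K)` with `Φ(T) = (0, λ' P')`, (V3) every `R ∈ W_K(K)` has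
`Q ∈ W(ℚ)`, `Q' ∈ W'(ℚ)` with `Φ(R) = (u λ Q, u λ' Q')` (global quadratic descent, Silverman Ex. 10.16).
[cite: SilvermanAEC2009, Exercise 10.16 and Prop. VII.6.3] -/
theorem exists_frameChart (W : WeierstrassCurve ℚ) [W.IsElliptic] [W.IsGloballyMinimal] (p : ℕ)
    [Fact p.Prime] {K : Type} [Field K] [NumberField K] {𝔭 : HeightOneSpectrum (𝓞 K)}
    {Wt : WeierstrassCurve ℚ} [Wt.IsElliptic] [Wt.IsGloballyMinimal] {C : VariableChange ℚ}
    (hF : X12.O11.IsFrame W p K 𝔭 Wt C) :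
    ∃ (Φ : ((W.baseChange K).baseChange (𝔭.adicCompletion K)).toAffine.Point →+ ℤ_[p] × ℤ_[p])
      (lam : (W.baseChange ℚ_[p]).toAffine.Point →+ ℤ_[p])
      (lam' : (Wt.baseChange ℚ_[p]).toAffine.Point →+ ℤ_[p]) (u : ℤ_[p]),
      (∀ x, Φ x = 0 ↔ IsOfFinAddOrder x) ∧ Function.Surjective Φ ∧
      (∀ X, lam X = 0 ↔ IsOfFinAddOrder X) ∧ Function.Surjective lam ∧
      (∀ X, lam' X = 0 ↔ IsOfFinAddOrder X) ∧ Function.Surjective lam' ∧ 2 * u = 1 ∧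
      (∀ Q : W.toAffine.Point,
        Φ (Affine.Point.baseChange (W' := W.baseChange K) K (𝔭.adicCompletion K)
          (Affine.Point.baseChange (W' := W) ℚ K Q)) = (lam (W.toPadicPoint p Q), 0)) ∧
      (∀ Q' : Wt.toAffine.Point, ∃ T : (W.baseChange K).toAffine.Point,
        Φ (Affine.Point.baseChange (W' := W.baseChange K) K (𝔭.adicCompletion K) T) =
          (0, lam' (Wt.toPadicPoint p Q'))) ∧
      (∀ R : (W.baseChange K).toAffine.Point, ∃ (Q : W.toAffine.Point) (Q' : Wt.toAffine.Point),
        Φ (Affine.Point.baseChange (W' := W.baseChange K) K (𝔭.adicCompletion K) R) =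
          (u * lam (W.toPadicPoint p Q), u * lam' (Wt.toPadicPoint p Q'))) := by
  have hp : p.Prime := Fact.out
  have hCM : W.HasCM := hF.1
  have hram : CMRamified W p := hF.2.1
  have h5 : 5 ≤ p := hF.2.2.1
  have hK : IsImaginaryQuadratic K := hF.2.2.2.1
  have hdisc : NumberField.discr K = cmFieldDiscrOfJ W.j := hF.2.2.2.2.1
  have h𝔭 : ((p : ℕ) : 𝓞 K) ∈ 𝔭.asIdeal := hF.2.2.2.2.2.1
  have hW' : C • W.quadraticTwist ((cmFieldDiscrOfJ W.j : ℤ) : ℚ) = Wt := hF.2.2.2.2.2.2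
  have hd : cmFieldDiscrOfJ W.j = -(p : ℤ) := X12.cmFieldDiscrOfJ_eq_neg_of_dvd W hCM hp h5 hram
  have hp2 : p ≠ 2 := by omega
  rw [hd] at hW'
  simp only [Int.cast_neg, Int.cast_natCast] at hW'
  -- no `p`-torsion over `ℚ_p` for `W` and for the twin `Wt`
  have hiso : IsIsogenous W Wt := isIsogenous_of_isFrame hF
  have hCM' : Wt.HasCM := X12.hasCM_of_isIsogenous hiso hCM
  have hram' : CMRamified Wt p := by
    change (p : ℤ) ∣ cmFieldDiscrOfJ Wt.j
    rw [← X12.cmFieldDiscrOfJ_eq_of_isIsogenous hiso hCM]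
    exact hram
  have hpW := prime_nsmul_eq_zero_padic_of_hasCM_of_cmRamified W p hCM h5 hram
  have hpW' := prime_nsmul_eq_zero_padic_of_hasCM_of_cmRamified Wt p hCM' h5 hram'
  -- the local fields `F = ℚ_v(p) ≃ ℚ_p` and `L = K_𝔭`, `[L : F] = 2`, `L = F(θ)`, `θ² = -p`
  haveI : 𝔭.asIdeal.LiesOver (ratPlace p).asIdeal := ⟨by rw [← under_eq_ratPlace_of_mem h𝔭]; rfl⟩
  set F : Type := (ratPlace p).adicCompletion ℚ with hFdef
  set L : Type := 𝔭.adicCompletion K with hLdef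
  haveI : CharZero F := charZero_of_injective_algebraMap (algebraMap ℚ F).injective
  haveI : CharZero L := charZero_of_injective_algebraMap (algebraMap K L).injective
  letI : Algebra F L := (adicCompletionMap (K := ℚ) K (ratPlace p) 𝔭).toAlgebra
  obtain ⟨hfin, hle⟩ := finrank_adicCompletion_le_of_liesOver (K := ℚ) K (ratPlace p) 𝔭
  haveI : FiniteDimensional F L := hfin
  have h2K : Module.finrank ℚ K = 2 := hK.1
  rw [h2K] at hle
  set eR : F ≃+* ℚ_[p] := (Padic.adicCompletionEquiv (𝓞 ℚ) ⟨p, hp⟩).symm.toAlgEquiv.toRingEquiv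
    with heR
  set eA : F ≃ₐ[ℚ] ℚ_[p] := AlgEquiv.ofRingEquiv (f := eR) (fun x ↦ RingHom.congr_fun
    (Subsingleton.elim (eR.toRingHom.comp (algebraMap ℚ F)) (algebraMap ℚ ℚ_[p])) x) with heA
  obtain ⟨θ₁, hθ₁, hθ₁sq⟩ := exists_sq_eq_discr_not_mem_range K hK.1
  rw [hdisc, hd] at hθ₁sq
  simp only [Int.cast_neg, Int.cast_natCast, map_neg, map_natCast] at hθ₁sq
  have hc₁ : θ₁ ^ 2 = algebraMap ℚ K (-(p : ℚ)) := by rw [hθ₁sq, map_neg, map_natCast]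
  set θ : L := algebraMap K L θ₁ with hθdef
  have hθsq : θ ^ 2 = algebraMap F L (-(p : F)) := by
    rw [map_neg, map_natCast, hθdef, ← map_pow, hθ₁sq, map_neg, map_natCast]
  have hθ : θ ∉ Set.range (algebraMap F L) := by
    rintro ⟨x, hx⟩
    have hx2 : x ^ 2 = -(p : F) :=
      (algebraMap F L).injective (by rw [map_pow, hx, hθsq, map_neg, map_natCast])
    apply not_sq_eq_neg_prime_padic p (eA x)
    rw [← map_pow, hx2, map_neg, map_natCast]
  have h2 : Module.finrank F L = 2 := by
    have hle' : Module.finrank F L ≤ 2 := hle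
    have hpos : 0 < Module.finrank F L := Module.finrank_pos
    have hne1 : Module.finrank F L ≠ 1 := by
      intro h1
      have hbot : (⊥ : Subalgebra F L) = ⊤ := Subalgebra.bot_eq_top_iff_finrank_eq_one.mpr h1
      apply hθ
      have hmem : θ ∈ (⊥ : Subalgebra F L) := by rw [hbot]; exact Algebra.mem_top
      rwa [Algebra.mem_bot] at hmem
    omega
  -- the field map `φ : K → L` and the matching of the conjugations
  set φ : K →ₐ[ℚ] L := (algebraMap K L).toRatAlgHom with hφdef
  have hφ : ∀ z, φ z = algebraMap K L z := fun _ ↦ rfl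
  have hφθ : φ θ₁ = θ := rfl
  have hcc := map_conj_eq_conj_map h2K hθ₁ hc₁ h2 hθ hθsq φ hφθ
  -- `2` is a unit of `ℤ_p`
  have h2unit : IsUnit ((2 : ℕ) : ℤ_[p]) := by
    rw [PadicInt.isUnit_iff, PadicInt.norm_natCast_eq_one_iff]
    exact (Nat.Prime.coprime_iff_not_dvd hp).mpr fun h ↦
      hp2 ((Nat.prime_dvd_prime_iff_eq hp Nat.prime_two).mp h)
  obtain ⟨u, hu⟩ := h2unit.exists_right_inv
  rw [Nat.cast_ofNat] at hu
  -- the charts `λ = Ψ`, `λ' = Ψ'` on `W(ℚ_p)`, `Wt(ℚ_p)` (AEC VII.6.3)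
  obtain ⟨A, hA, ⟨φA⟩⟩ := exists_finiteIndex_addEquiv_padicInt_holds p (W.baseChange ℚ_[p])
  haveI := hA
  obtain ⟨A', hA', ⟨φA'⟩⟩ := exists_finiteIndex_addEquiv_padicInt_holds p (Wt.baseChange ℚ_[p])
  haveI := hA'
  -- completed-square model and twist over `F`
  obtain ⟨C₀, hC₀⟩ := W.exists_variableChange_quadraticTwist_one
  have hC_F : C₀.map (algebraMap ℚ F) • W.baseChange F = (W.baseChange F).quadraticTwist 1 :=
    map_smul_baseChange_eq W C₀ hC₀
  have hVF : (W.quadraticTwist 1).baseChange F = (W.baseChange F).quadraticTwist 1 :=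
    baseChange_quadraticTwist_one W
  have hWcF : (W.quadraticTwist (-(p : ℚ))).baseChange F =
      (W.baseChange F).quadraticTwist (-(p : F)) := baseChange_quadraticTwist_neg_natCast W p
  have hWd : C.map (algebraMap ℚ F) • (W.baseChange F).quadraticTwist (-(p : F)) =
      Wt.baseChange F := by
    rw [← hWcF, ← VariableChange.baseChange_smul_eq, hW']
  -- the local charts on the two `F`-models
  set isoF : (W.baseChange F).toAffine.Point ≃+ ((W.baseChange F).quadraticTwist 1).toAffine.Point :=
    (VariableChange.pointEquiv (W.baseChange F) (C₀.map (algebraMap ℚ F))).trans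
      (Affine.Point.congrEquiv hC_F) with hisoF
  set isoF' : ((W.baseChange F).quadraticTwist (-(p : F))).toAffine.Point ≃+
      (Wt.baseChange F).toAffine.Point :=
    (VariableChange.pointEquiv ((W.baseChange F).quadraticTwist (-(p : F)))
      (C.map (algebraMap ℚ F))).trans (Affine.Point.congrEquiv hWd) with hisoF'
  set lamF : ((W.baseChange F).quadraticTwist 1).toAffine.Point →+ ℤ_[p] :=
    (LocalIndex.psi A φA).comp ((Affine.Point.map (W' := W) (eA : F →ₐ[ℚ] ℚ_[p])).comp
      isoF.symm.toAddMonoidHom) with hlamF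
  set lamF' : ((W.baseChange F).quadraticTwist (-(p : F))).toAffine.Point →+ ℤ_[p] :=
    (LocalIndex.psi A' φA').comp ((Affine.Point.map (W' := Wt) (eA : F →ₐ[ℚ] ℚ_[p])).comp
      isoF'.toAddMonoidHom) with hlamF'
  have hlamF_apply : ∀ a, lamF a = LocalIndex.psi A φA
      (Affine.Point.map (W' := W) (eA : F →ₐ[ℚ] ℚ_[p]) (isoF.symm a)) := fun _ ↦ rfl
  have hlamF'_apply : ∀ b, lamF' b = LocalIndex.psi A' φA'
      (Affine.Point.map (W' := Wt) (eA : F →ₐ[ℚ] ℚ_[p]) (isoF' b)) := fun _ ↦ rfl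
  have hlamF0 : ∀ a, lamF a = 0 ↔ IsOfFinAddOrder a := fun a ↦ by
    rw [hlamF_apply, LocalIndex.psi_eq_zero_iff,
      (Affine.Point.map_injective (W' := W) _).isOfFinAddOrder_iff]
    exact isoF.symm.injective.isOfFinAddOrder_iff (f := isoF.symm.toAddMonoidHom)
  have hlamF'0 : ∀ b, lamF' b = 0 ↔ IsOfFinAddOrder b := fun b ↦ by
    rw [hlamF'_apply, LocalIndex.psi_eq_zero_iff,
      (Affine.Point.map_injective (W' := Wt) _).isOfFinAddOrder_iff]
    exact isoF'.injective.isOfFinAddOrder_iff (f := isoF'.toAddMonoidHom)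
  have hlamFs : Function.Surjective lamF :=
    (LocalIndex.psi_surjective A φA hpW).comp
      ((map_algEquiv_surjective W eA).comp isoF.symm.surjective)
  have hlamF's : Function.Surjective lamF' :=
    (LocalIndex.psi_surjective A' φA' hpW').comp
      ((map_algEquiv_surjective Wt eA).comp isoF'.surjective)
  -- the `±`-chart on `X = (W_F^{(1)})(L)`
  obtain ⟨ΦX, hΦX0, hΦXs, hΦXval, hΦXsum⟩ := exists_plusMinusChart
    (incl L ((W.baseChange F).quadraticTwist 1)) (twistMap (W.baseChange F) hθ hθsq)
    (conjMap ((W.baseChange F).quadraticTwist 1) (Quadratic.conj h2 hθ hθsq))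
    (incl_injective _) (twistMap_injective (W.baseChange F) hθ hθsq)
    (fun a ↦ conjMap_incl _ _ a)
    (fun b ↦ conjMap_twistMap (W.baseChange F) hθ hθsq (Quadratic.conj_gen h2 hθ hθsq) b)
    (fun x ↦ add_conjMap_mem_range_incl (W.baseChange F) h2 hθ hθsq x)
    (fun x ↦ sub_conjMap_mem_range_twistMap (W.baseChange F) h2 hθ hθsq x)
    lamF lamF' hlamF0 hlamF'0 hlamFs hlamF's hu
  -- the transport `ε : (W_K ⊗ L)(L) ≃ X`
  have hKL : (W.baseChange K).baseChange L = W.baseChange L := baseChange_baseChange W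
  have hBC : (W.quadraticTwist 1).baseChange L = ((W.baseChange F).quadraticTwist 1).baseChange L :=
    baseChange_quadraticTwist_one_eq_baseChange W
  set ε : ((W.baseChange K).baseChange L).toAffine.Point ≃+
      (((W.baseChange F).quadraticTwist 1).baseChange L).toAffine.Point :=
    (Affine.Point.congrEquiv hKL).trans ((VariableChange.pointEquivBaseChange W C₀ L).trans
      ((Affine.Point.congrEquiv (congrArg (fun V : WeierstrassCurve ℚ ↦ V.baseChange L) hC₀)).trans
        (Affine.Point.congrEquiv hBC))) with hε
  -- (k1) `ε` of a `K`-point = bridge of its completed-square coordinates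
  have hk1 : ∀ R : (W.baseChange K).toAffine.Point,
      ε (Affine.Point.baseChange (W' := W.baseChange K) K L R) =
        Affine.Point.congrEquiv hBC (Affine.Point.map (W' := W.quadraticTwist 1) φ
          (Affine.Point.congrEquiv (congrArg (fun V : WeierstrassCurve ℚ ↦ V.baseChange K) hC₀)
            (VariableChange.pointEquivBaseChange W C₀ K R))) := fun R ↦ by
    rw [hε, AddEquiv.trans_apply, AddEquiv.trans_apply, AddEquiv.trans_apply,
      congrEquiv_baseChange_baseChange W φ hKL hφ R, ← VariableChange.pointEquivBaseChange_map,
      ← map_congrEquiv_baseChange hC₀ φ]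
  -- (k6), (k7): the local charts on base-changed rational points
  have hk6 : ∀ Q : W.toAffine.Point,
      lamF (Affine.Point.congrEquiv hVF (Affine.Point.baseChange (W' := W.quadraticTwist 1) ℚ F
        (Affine.Point.congrEquiv hC₀ (VariableChange.pointEquiv W C₀ Q)))) =
      LocalIndex.psi A φA (W.toPadicPoint p Q) := fun Q ↦ by
    have hpt : isoF.symm (Affine.Point.congrEquiv hVF (Affine.Point.baseChange
        (W' := W.quadraticTwist 1) ℚ F
        (Affine.Point.congrEquiv hC₀ (VariableChange.pointEquiv W C₀ Q)))) =
        Affine.Point.baseChange (W' := W) ℚ F Q := by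
      rw [AddEquiv.symm_apply_eq]
      exact (congrEquiv_pointEquiv_baseChange C₀ hC₀ rfl hC_F hVF Q).symm
    rw [hlamF_apply, hpt, Affine.Point.map_baseChange]
    rfl
  have hk7 : ∀ R'' : (W.quadraticTwist (-(p : ℚ))).toAffine.Point,
      lamF' (Affine.Point.congrEquiv hWcF
        (Affine.Point.baseChange (W' := W.quadraticTwist (-(p : ℚ))) ℚ F R'')) =
      LocalIndex.psi A' φA' (Wt.toPadicPoint p
        (Affine.Point.congrEquiv hW' (VariableChange.pointEquiv _ C R''))) := fun R'' ↦ by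
    have hpt : isoF' (Affine.Point.congrEquiv hWcF
        (Affine.Point.baseChange (W' := W.quadraticTwist (-(p : ℚ))) ℚ F R'')) =
        Affine.Point.baseChange (W' := Wt) ℚ F
          (Affine.Point.congrEquiv hW' (VariableChange.pointEquiv _ C R'')) :=
      congrEquiv_pointEquiv_baseChange C hW' hWcF hWd rfl R''
    rw [hlamF'_apply, hpt, Affine.Point.map_baseChange]
    rfl
  refine ⟨ΦX.comp ε.toAddMonoidHom, LocalIndex.psi A φA, LocalIndex.psi A' φA', u,
    fun x ↦ ?_, hΦXs.comp ε.surjective, LocalIndex.psi_eq_zero_iff A φA,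
    LocalIndex.psi_surjective A φA hpW, LocalIndex.psi_eq_zero_iff A' φA',
    LocalIndex.psi_surjective A' φA' hpW', hu, fun Q ↦ ?_, fun Q' ↦ ?_, fun R ↦ ?_⟩
  · -- kernel = torsion
    rw [AddMonoidHom.comp_apply, AddEquiv.coe_toAddMonoidHom, hΦX0]
    exact ε.injective.isOfFinAddOrder_iff (f := ε.toAddMonoidHom)
  · -- (V1) rational points
    rw [AddMonoidHom.comp_apply, AddEquiv.coe_toAddMonoidHom, hk1,
      congrEquiv_pointEquivBaseChange_baseChange W C₀ hC₀ Q, bridge_incl W φ]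
    have hsum := hΦXsum (Affine.Point.congrEquiv hVF (Affine.Point.baseChange
      (W' := W.quadraticTwist 1) ℚ F
      (Affine.Point.congrEquiv hC₀ (VariableChange.pointEquiv W C₀ Q)))) 0
    rw [map_zero, add_zero] at hsum
    rw [hsum, map_zero, hk6]
  · -- (V2) twisted rational points
    set R'' : (W.quadraticTwist (-(p : ℚ))).toAffine.Point :=
      (VariableChange.pointEquiv _ C).symm ((Affine.Point.congrEquiv hW').symm Q') with hR''
    refine ⟨(VariableChange.pointEquivBaseChange W C₀ K).symm
      ((Affine.Point.congrEquiv (congrArg (fun V : WeierstrassCurve ℚ ↦ V.baseChange K) hC₀)).symm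
        (twistMap W hθ₁ hc₁ R'')), ?_⟩
    rw [AddMonoidHom.comp_apply, AddEquiv.coe_toAddMonoidHom, hk1, AddEquiv.apply_symm_apply,
      AddEquiv.apply_symm_apply, bridge_twistMap W φ p hθ₁ hc₁ hθ hθsq hφθ R'']
    have hsum := hΦXsum 0 (Affine.Point.congrEquiv hWcF
      (Affine.Point.baseChange (W' := W.quadraticTwist (-(p : ℚ))) ℚ F R''))
    rw [map_zero, zero_add] at hsum
    rw [hsum, map_zero, hk7, hR'', AddEquiv.apply_symm_apply, AddEquiv.apply_symm_apply]
  · -- (V3) all `K`-points: global quadratic descent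
    set y := Affine.Point.congrEquiv (congrArg (fun V : WeierstrassCurve ℚ ↦ V.baseChange K) hC₀)
      (VariableChange.pointEquivBaseChange W C₀ K R) with hy
    obtain ⟨Q₁, hQ₁⟩ := add_conjMap_mem_range_incl W h2K hθ₁ hc₁ y
    obtain ⟨R'', hR''⟩ := sub_conjMap_mem_range_twistMap W h2K hθ₁ hc₁ y
    refine ⟨(VariableChange.pointEquiv W C₀).symm ((Affine.Point.congrEquiv hC₀).symm Q₁),
      Affine.Point.congrEquiv hW' (VariableChange.pointEquiv _ C R''), ?_⟩
    rw [AddMonoidHom.comp_apply, AddEquiv.coe_toAddMonoidHom, hk1, ← hy]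
    have hplus : incl L ((W.baseChange F).quadraticTwist 1) (Affine.Point.congrEquiv hVF
        (Affine.Point.baseChange (W' := W.quadraticTwist 1) ℚ F Q₁)) =
        Affine.Point.congrEquiv hBC (Affine.Point.map (W' := W.quadraticTwist 1) φ y) +
          conjMap ((W.baseChange F).quadraticTwist 1) (Quadratic.conj h2 hθ hθsq)
            (Affine.Point.congrEquiv hBC (Affine.Point.map (W' := W.quadraticTwist 1) φ y)) := by
      rw [← bridge_incl W φ Q₁, hQ₁, map_add, map_add,
        bridge_conjMap W φ h2K hθ₁ hc₁ h2 hθ hθsq hcc]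
    have hminus : twistMap (W.baseChange F) hθ hθsq (Affine.Point.congrEquiv hWcF
        (Affine.Point.baseChange (W' := W.quadraticTwist (-(p : ℚ))) ℚ F R'')) =
        Affine.Point.congrEquiv hBC (Affine.Point.map (W' := W.quadraticTwist 1) φ y) -
          conjMap ((W.baseChange F).quadraticTwist 1) (Quadratic.conj h2 hθ hθsq)
            (Affine.Point.congrEquiv hBC (Affine.Point.map (W' := W.quadraticTwist 1) φ y)) := by
      rw [← bridge_twistMap W φ p hθ₁ hc₁ hθ hθsq hφθ R'', hR'', map_sub, map_sub,
        bridge_conjMap W φ h2K hθ₁ hc₁ h2 hθ hθsq hcc]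
    rw [hΦXval _ _ _ hplus hminus, hk7]
    have hk6' := hk6 ((VariableChange.pointEquiv W C₀).symm ((Affine.Point.congrEquiv hC₀).symm Q₁))
    rw [AddEquiv.apply_symm_apply, AddEquiv.apply_symm_apply] at hk6'
    rw [hk6']

end Frame

end Summit.BirchSwinnertonDyer.BirchSwinnertonDyer.Theorems.RamifiedSevenEllipticUnits.KummerCore

end
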